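import Summits.BirchSwinnertonDyer.BirchSwinnertonDyer.Theorems.ManinLocalTwoThreeKummerCubeAnalyticLocalParam
import Literature.NumberTheory.EllipticCurves.FormalLogExpBaseChangeProofs
import Literature.NumberTheory.EllipticCurves.RealLatticePeriod
import HarnessLib

/-!
# Leaf S1 `KummerCubeAnalyticDictionary` CLOSED: the formal `Θ_T(q)` is the `q`-expansion of `Θ_T^an`
# (route `ManinLocalTwoThree`, crux C3 `ManinPrimeToThreeAtNine` stmt-BirchSwinnertonDyer-22968; cell bsd-f2-manin, an g37, MEMO-an §80.9)

`kummerCubeAnalyticDictionary : KummerCubeAnalyticDictionary` (statement file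
`Rank1Residual/ManinAdditive/KummerCubeMonodromy.lean`, S1): for an optimal datum `D`, `c ≠ 0`, a parameter germ `z`
(`IsParamGerm W c a z`: `log_{E_{W,c}}(z) = Σ (aₙ/n) qⁿ`) and any `X₀ Y₀`, there is `B` with
`HasSum (n ↦ coeffₙ(kummerCubeSeries W c X₀ Y₀ z) · q(τ)ⁿ) (kummerCubeFunction D X₀ Y₀ τ)` for `Im τ > B`.

Proof.  With `V = E_{W,c} ⊗ ℂ` (`shortModel`, `c₄(V) = c⁴c₄`, `c₆(V) = c⁶c₆`) and the homothetic pair `L' = c⁻¹Λ_W`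
(`PeriodPair.mulLeft`; Néron hypotheses `isNeron_shortModel` from `D.isNeronLattice`, `g₂/g₃_mulLeft`), the homothety
formulas `℘_{c⁻¹Λ}(u) = c²℘_Λ(cu)`, `℘' ↦ c³℘'` (`weierstrassP_mulLeft`, `derivWeierstrassP_mulLeft`) give
`Θ_T^an(τ) = locKummer L' V α X₀ Y₀ (E_f τ)` off `L'` (`kummerCubeFunction_eq_locKummer`).  Hence
`Θ_T^an = K ∘ q` near the cusp with the analytic germ `K = locKummer ∘ ε` (`ε = qGerm f`, prelims 1/2), and
`𝓣[K] = 𝓣[locKummer].subst 𝓣[ε] = formalKummer(exp_V(Σ aₙXⁿ/n))` (`taylorAt0_comp`, `taylorAt0_locKummer`,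
`taylorAt0_qGerm`, `subst_comp_subst_apply`).  The hypothesis `IsParamGerm`, base-changed to `ℂ` (`map_formalLog`),
reads `log_V(z_ℂ) = Σ aₙXⁿ/n`, so `exp_V(Σ aₙXⁿ/n) = z_ℂ` (`formalExp_subst_formalLog`) and
`𝓣[K] = formalKummer(z_ℂ) = (kummerCubeSeries W c X₀ Y₀ z).map (algebraMap ℚ ℂ)` (`map_formalXMulSq`,
`formalYMulCube = −formalXMulSq`).  Taylor's theorem on a ball (`exists_hasSum_taylorAt0`) and `exists_im_bound`
(`E_f(τ) ∉ c⁻¹Λ` and `|q(τ)| < r` for `Im τ` large, from `a₁(f) = 1`) finish.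

With this leaf the seven leaves S1–S6, S3′ of the `σ`-monodromy line are all closed; the kernel-checked composition
`KummerCubeMonodromy.kummerCubeSeriesNotCubeAtThreeN_of_monodromy` then gives P79 `KummerCubeSeriesNotCubeAtThreeN`
(= `stub_kummerCubeSeriesNotCubeAtThreeN` of the registered C3 skeleton `kato_shift_three` v19) and G0 — see
`Theorems/ManinLocalTwoThreeKummerCubeNotCube.lean`.
HONEST FRAMING: a routine analytic leaf of a CONDITIONAL reduction; E-an-57, C3 `ManinPrimeToThreeAtNine`, Manin's `c = 1`
remain OPEN; nothing about BSD is proved.  PARTITION unchanged · beyond-print theorem: no · BSD is not proved by this.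
[cite: SilvermanAEC2009, IV.1, VI.3.6 (shape)] [cite: Bost2001AlgebraicLeaves, §3.4.1 (shape)] [cite: Manin1972, Thm. 1.9 (shape of P79)]
-/

set_option autoImplicit false
-- lint-debt: the directory name repeats the summit name (sibling precedent `ManinLocalTwoThreeKummerCubeSigmaLeaves.lean`)
set_option linter.dupNamespace false

noncomputable section

open Complex Filter Topology PowerSeries CongruenceSubgroup
open scoped PeriodPair UpperHalfPlane MatrixGroups ModularForm Nat Classical
open WeierstrassCurve Literature.NumberTheory.EllipticCurves Literature.NumberTheory.EllipticCurves.ModularForms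
open Literature.NumberTheory.Transcendental.AndreCriterion UpperHalfPlane
open Summit.BirchSwinnertonDyer.Rank1Residual.ManinAdditive.CuspidalKummer
open Summit.BirchSwinnertonDyer.Rank1Residual.ManinAdditive.CuspidalKummerThree

namespace Summit.BirchSwinnertonDyer.BirchSwinnertonDyer.Theorems.ManinLocalTwoThree.KummerCubeAnalytic

open Summit.BirchSwinnertonDyer.Rank1Residual.ManinAdditive.KummerCubeMonodromy

/-! #### The short model `E_{W,c}` over `ℂ` and the homothetic Néron pair `c⁻¹Λ` -/

/-- `c₄(E_{W,c}) = c⁴·c₄(W)` for the short model `E_{W,c}` (`shortModel`). [folklore] -/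
theorem c₄_shortModel (W : WeierstrassCurve ℚ) (c : ℤ) :
    (shortModel W c).c₄ = (c : ℚ) ^ 4 * W.c₄ := by
  simp only [shortModel, WeierstrassCurve.c₄, WeierstrassCurve.b₂, WeierstrassCurve.b₄]
  ring

/-- `c₆(E_{W,c}) = c⁶·c₆(W)` for the short model `E_{W,c}` (`shortModel`). [folklore] -/
theorem c₆_shortModel (W : WeierstrassCurve ℚ) (c : ℤ) :
    (shortModel W c).c₆ = (c : ℚ) ^ 6 * W.c₆ := by
  simp only [shortModel, WeierstrassCurve.c₆, WeierstrassCurve.b₂, WeierstrassCurve.b₄,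
    WeierstrassCurve.b₆]
  ring

/-- The Néron hypotheses for the pair (`E_{W,c}/ℂ`, `c⁻¹Λ_W`). [folklore] -/
theorem isNeron_shortModel (W : WeierstrassCurve ℚ) {N : ℕ} [NeZero N] (D : ModularParametrizationData W N)
    (hc : (D.c : ℂ) ≠ 0) :
    (D.L.mulLeft ((D.c : ℂ)⁻¹) (inv_ne_zero hc)).g₂ =
        ((shortModel W D.c).map (algebraMap ℚ ℂ)).c₄ / 12 ∧
      (D.L.mulLeft ((D.c : ℂ)⁻¹) (inv_ne_zero hc)).g₃ =
        ((shortModel W D.c).map (algebraMap ℚ ℂ)).c₆ / 216 := by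
  obtain ⟨hg₂, hg₃⟩ := D.isNeronLattice
  simp only [WeierstrassCurve.baseChange, WeierstrassCurve.map_c₄, WeierstrassCurve.map_c₆,
    eq_ratCast] at hg₂ hg₃
  refine ⟨?_, ?_⟩
  · rw [PeriodPair.g₂_mulLeft, hg₂, WeierstrassCurve.map_c₄, c₄_shortModel, inv_pow, inv_inv]
    simp only [eq_ratCast, Rat.cast_mul, Rat.cast_pow, Rat.cast_intCast]
    ring
  · rw [PeriodPair.g₃_mulLeft, hg₃, WeierstrassCurve.map_c₆, c₆_shortModel, inv_pow, inv_inv]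
    simp only [eq_ratCast, Rat.cast_mul, Rat.cast_pow, Rat.cast_intCast]
    ring

/-- Off the lattice `c⁻¹Λ`, `Θ_T^an(τ)` is the Kummer germ of the short model at `E_f(τ)`
(homothety `℘_{c⁻¹Λ}(u) = c²℘_Λ(cu)`, `℘'_{c⁻¹Λ}(u) = c³℘'_Λ(cu)`). [folklore] -/
theorem kummerCubeFunction_eq_locKummer (W : WeierstrassCurve ℚ) {N : ℕ} [NeZero N]
    (D : ModularParametrizationData W N) (hc : (D.c : ℂ) ≠ 0) (X₀ Y₀ : ℚ) (τ : ℍ)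
    (hτ : eichlerIntegral D.f τ ∉ (D.L.mulLeft ((D.c : ℂ)⁻¹) (inv_ne_zero hc)).lattice) :
    kummerCubeFunction D X₀ Y₀ τ =
      locKummer (D.L.mulLeft ((D.c : ℂ)⁻¹) (inv_ne_zero hc)) ((shortModel W D.c).map (algebraMap ℚ ℂ))
        ((tangentSlope W D.c X₀ Y₀ : ℚ) : ℂ) (X₀ : ℂ) (Y₀ : ℂ) (eichlerIntegral D.f τ) := by
  set L' := D.L.mulLeft ((D.c : ℂ)⁻¹) (inv_ne_zero hc) with hL'
  set u := eichlerIntegral D.f τ with hu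
  have hP : ℘[L'] u = (D.c : ℂ) ^ 2 * ℘[D.L] ((D.c : ℂ) * u) := by
    have h := PeriodPair.weierstrassP_mulLeft ((D.c : ℂ)⁻¹) (inv_ne_zero hc) D.L ((D.c : ℂ) * u)
    rw [inv_mul_cancel_left₀ hc, inv_pow, inv_inv] at h
    exact h
  have hP' : ℘'[L'] u = (D.c : ℂ) ^ 3 * ℘'[D.L] ((D.c : ℂ) * u) := by
    have h := PeriodPair.derivWeierstrassP_mulLeft ((D.c : ℂ)⁻¹) (inv_ne_zero hc) D.L ((D.c : ℂ) * u)
    rw [inv_mul_cancel_left₀ hc, inv_pow, inv_inv] at h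
    exact h
  have ha₁ : ((shortModel W D.c).map (algebraMap ℚ ℂ)).a₁ = 0 := by simp [shortModel]
  have ha₃ : ((shortModel W D.c).map (algebraMap ℚ ℂ)).a₃ = 0 := by simp [shortModel]
  have hb₂ : ((shortModel W D.c).map (algebraMap ℚ ℂ)).b₂ = 0 := by
    simp [shortModel, WeierstrassCurve.b₂]
  simp only [kummerCubeFunction, shortT, shortX, shortY, locKummer, locG, locT, if_neg hτ, ha₁, ha₃, hb₂,
    zero_div, sub_zero, zero_mul, ← hu, hP, hP']
  by_cases hy : ℘'[D.L] ((D.c : ℂ) * u) = 0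
  · rw [hy]; simp
  · field_simp
    ring

/-- For `Im τ` large: `E_f(τ) ∉ c⁻¹Λ` and `|q(τ)| < r`. [folklore] -/
theorem exists_im_bound (W : WeierstrassCurve ℚ) {N : ℕ} [NeZero N] (D : ModularParametrizationData W N)
    (hc : (D.c : ℂ) ≠ 0) {r : ℝ} (hr : 0 < r) :
    ∃ B : ℝ, ∀ τ : ℍ, B < τ.im →
      eichlerIntegral D.f τ ∉ (D.L.mulLeft ((D.c : ℂ)⁻¹) (inv_ne_zero hc)).lattice ∧
        ‖Function.Periodic.qParam 1 (τ : ℂ)‖ < r := by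
  have hf1 : cuspCoeff D.f 1 = 1 := D.isNewformOf.1.2.2
  have h1 := eventually_qGerm_notMem D.f hf1 (D.L.mulLeft ((D.c : ℂ)⁻¹) (inv_ne_zero hc))
  have h2 : ∀ᶠ q in 𝓝[≠] (0 : ℂ), ‖q‖ < r := by
    refine mem_nhdsWithin_of_mem_nhds ?_
    have : Metric.ball (0 : ℂ) r ∈ 𝓝 (0 : ℂ) := Metric.ball_mem_nhds 0 hr
    filter_upwards [this] with q hq
    rwa [Metric.mem_ball, dist_zero_right] at hq
  obtain ⟨B, hB⟩ := exists_im_bound_of_eventually (h1.and h2)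
  refine ⟨B, fun τ hτ => ?_⟩
  have h := hB τ hτ
  rw [qGerm_apply] at h
  exact h

/-- `map` commutes with one-variable substitution (univariate form of `PowerSeries.map_subst`). [folklore] -/
theorem map_subst_univ {f g : ℚ⟦X⟧} (hg : HasSubst g) :
    PowerSeries.map (algebraMap ℚ ℂ) (f.subst g) =
      (PowerSeries.map (algebraMap ℚ ℂ) f).subst (PowerSeries.map (algebraMap ℚ ℂ) g) := by
  change MvPowerSeries.map (algebraMap ℚ ℂ) (f.subst g) = _
  rw [PowerSeries.map_subst hg]
  rfl

/-! #### S1 assembled -/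

/-- **S1 — the formal/analytic dictionary for the Kummer cube function** (`KummerCubeAnalyticDictionary`):
for `Im τ` large, `Θ_T^an(τ) = Σₙ coeffₙ(kummerCubeSeries) q(τ)ⁿ`. [folklore] -/
theorem kummerCubeAnalyticDictionary : KummerCubeAnalyticDictionary := by
  intro W _ _ N _ D a ha hc X₀ Y₀ z hz
  have hcC : (D.c : ℂ) ≠ 0 := by exact_mod_cast hc
  set L' := D.L.mulLeft ((D.c : ℂ)⁻¹) (inv_ne_zero hcC) with hL'
  set V := (shortModel W D.c).map (algebraMap ℚ ℂ) with hV
  set α : ℂ := ((tangentSlope W D.c X₀ Y₀ : ℚ) : ℂ) with hα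
  obtain ⟨h₂, h₃⟩ := isNeron_shortModel W D hcC
  rw [← hL', ← hV] at h₂ h₃
  -- the analytic germ `K = locKummer ∘ ε` in the variable `q`
  set K : ℂ → ℂ := locKummer L' V α (X₀ : ℂ) (Y₀ : ℂ) ∘ qGerm D.f with hK
  have hε := analyticAt_qGerm D.f
  have hε0 := qGerm_zero D.f
  have hH := analyticAt_locKummer L' V α (X₀ : ℂ) (Y₀ : ℂ)
  have hKa : AnalyticAt ℂ K 0 := by
    have h' : AnalyticAt ℂ (locKummer L' V α (X₀ : ℂ) (Y₀ : ℂ)) (qGerm D.f 0) := by rw [hε0]; exact hH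
    exact h'.comp hε
  obtain ⟨r, hr, hsum⟩ := exists_hasSum_taylorAt0 hKa
  obtain ⟨B, hB⟩ := exists_im_bound W D hcC hr
  -- the Taylor series of `K` is `kummerCubeSeries` (base-changed to `ℂ`)
  have hE0 : constantCoeff V.formalExp = 0 := V.constantCoeff_formalExp
  have hsE : HasSubst V.formalExp := HasSubst.of_constantCoeff_zero' hE0
  set zC : PowerSeries ℂ := z.map (algebraMap ℚ ℂ) with hzC
  have hz0 : constantCoeff zC = 0 := by
    rw [hzC, ← coeff_zero_eq_constantCoeff_apply, coeff_map, coeff_zero_eq_constantCoeff_apply, hz.1,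
      map_zero]
  have hsz : HasSubst zC := HasSubst.of_constantCoeff_zero' hz0
  have hszQ : HasSubst z := HasSubst.of_constantCoeff_zero' hz.1
  set ℓ : PowerSeries ℂ := PowerSeries.mk fun n => cuspCoeff D.f n / n with hℓ
  -- `ℓ = log_V(zC)` (from `IsParamGerm`, base-changed)
  have hlog : V.formalLog.subst zC = ℓ := by
    have h := congrArg (PowerSeries.map (algebraMap ℚ ℂ)) hz.2
    rw [map_subst_univ hszQ, WeierstrassCurve.map_formalLog] at h
    rw [hV, hzC, h, hℓ]
    ext n
    rw [coeff_map, lSeriesLog, coeff_mk, coeff_mk, ← ha n]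
    simp
  have hsL : HasSubst V.formalLog := HasSubst.of_constantCoeff_zero' V.constantCoeff_formalLog
  -- `exp_V(ℓ) = zC`
  have hexp : V.formalExp.subst ℓ = zC := by
    rw [← hlog, ← PowerSeries.subst_comp_subst_apply hsL hsz, V.formalExp_subst_formalLog,
      PowerSeries.subst_X hsz]
  have hT : taylorAt0 K = (kummerCubeSeries W D.c X₀ Y₀ z).map (algebraMap ℚ ℂ) := by
    rw [hK, taylorAt0_comp hH hε hε0, taylorAt0_locKummer L' V h₂ h₃, taylorAt0_qGerm, ← hℓ,
      PowerSeries.subst_comp_subst_apply hsE (HasSubst.of_constantCoeff_zero' (by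
        rw [hℓ, ← coeff_zero_eq_constantCoeff_apply, coeff_mk]; simp)) _, hexp]
    -- both sides are the explicit polynomial in `zC` and `formalXMulSq(zC)`
    have hsXq : (shortModel W D.c).formalXMulSq.map (algebraMap ℚ ℂ) = V.formalXMulSq := by
      rw [hV, WeierstrassCurve.map_formalXMulSq]
    have hrhs : (kummerCubeSeries W D.c X₀ Y₀ z).map (algebraMap ℚ ℂ) =
        -(V.formalXMulSq.subst zC) - C (Y₀ : ℂ) * zC ^ 3 -
          C α * (V.formalXMulSq.subst zC * zC - C (X₀ : ℂ) * zC ^ 3) := by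
      rw [kummerCubeSeries, show (shortModel W D.c).formalYMulCube = -(shortModel W D.c).formalXMulSq
        from rfl, smul_eq_C_mul, smul_eq_C_mul, smul_eq_C_mul]
      simp only [map_sub, map_mul, map_pow, map_neg, PowerSeries.map_C, map_subst_univ hszQ,
        hsXq, ← hzC, eq_ratCast, hα]
      rw [← coe_substAlgHom hsz, map_neg, coe_substAlgHom]
    rw [hrhs, formalKummer, ← coe_substAlgHom hsz]
    simp only [map_sub, map_neg, map_mul, map_pow, substAlgHom_X hsz,
      Literature.NumberTheory.EllipticCurves.substAlgHom_C hsz, coe_substAlgHom]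
  refine ⟨B, fun τ hτ => ?_⟩
  obtain ⟨hτΛ, hτq⟩ := hB τ hτ
  have hS := hsum _ hτq
  have hKq : K (Function.Periodic.qParam 1 (τ : ℂ)) = kummerCubeFunction D X₀ Y₀ τ := by
    rw [hK, Function.comp_apply, qGerm_apply]
    exact (kummerCubeFunction_eq_locKummer W D hcC X₀ Y₀ τ hτΛ).symm
  rw [hKq, hT] at hS
  have hfun : (fun n : ℕ => ((coeff n (kummerCubeSeries W D.c X₀ Y₀ z) : ℚ) : ℂ) *
      Function.Periodic.qParam 1 (τ : ℂ) ^ n) =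
      fun n : ℕ => coeff n ((kummerCubeSeries W D.c X₀ Y₀ z).map (algebraMap ℚ ℂ)) *
        Function.Periodic.qParam 1 (τ : ℂ) ^ n := by
    funext n
    rw [coeff_map, eq_ratCast]
  rw [hfun]
  exact hS

end Summit.BirchSwinnertonDyer.BirchSwinnertonDyer.Theorems.ManinLocalTwoThree.KummerCubeAnalytic

end
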